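import Literature.MathematicalPhysics.QuantumFieldTheory.Balaban1983to89.B15Prop1LocalChartFromThm1AtBaseCentral
import Literature.MathematicalPhysics.QuantumFieldTheory.Balaban1983to89.Node00.MultiScaleFibreChartB

/-!
# `Balaban1983to89.B15Prop1LocalChartFromThm1AtBaseCentral` — [Balaban1985Variational] = «[15]», Thm 1 p. 279, (2) p. 278 (the class on the domains `Ω_j`), (4) p. 278, Prop. 8 p. 305, — **BOND-DATUM EDITION** (`…B15Prop1LocalChartFromThm1AtBaseCentralB`, USED DECLARATIONS ONLY): the print-datum ([Balaban1984PropagatorsII] (2.3)) twins of the declarations of `B15Prop1LocalChartFromThm1AtBaseCentral` that N12's junction of record v14ᴸ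
uses with a datum-bearing statement (`datum_gaugeAct_of_central`) — class (γ) of dag-n12-c's census-by-declaration v2 (bus [DAGN12C-G35], 2026-08-30).  GENERATOR (block-extracted from the
parent's tree bytes by HOME `lean/g35/gen/gen_blocks.py`): namespace `…B`, SAME names, `DetSet ↦ BDetSet` (F0a), `AgreeOn ↦ AgreeOnB`, `IsMinimizer ↦ IsMinimizerB`, `bondsOf (𝐁 j) ↦ 𝔅 j`, `constrCard ∕
constrEnum ∕ ConstrSet ∕ msChart ↦ …B` (lane `Node00/MultiScaleFibreChartB`), `IsCritOnFibre ∕ IsFibreChartNear ↦ …B`; proofs VERBATIM; the parent's other (datum-free) declarations REUSED by `open`.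

statement-level skeleton of published theorems with citation tags; proofs where landed; nothing here is a claim about
the Yang–Mills mass gap

Cell `pub-ymgap` (HUMAN RULINGS D-0062 ∕ D-0149), lane `pub-ymgap-dag-n12-c` g35 (R134 seat (a), N12 = [B15], s1, lane owner); `--kind proof --supports` K1⁹ `stmt-QuantumFields-27364`; count-neutral.
THEOREMS ONLY (0 `def`, 0 `instance`, 0 `sorry`).  HONESTY GUARD (director-ym №338 (5)): PURELY ADDITIVE — the parent stays landed and true on its own text; nothing in it is edited; no displayed
premise of any consumer is deleted or weakened; every hypothesis stays a hypothesis.  Nothing of Bałaban's analysis asserted; N12 NOT discharged; K0⁷ ∕ K1⁹ NOT closed; one finite 𝕋⁴ programme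
at fixed ε — nothing continuum ∕ ℝ⁴ ∕ OS; the Yang–Mills mass gap (Clay) is NOT proved by any of this.

PARENT's DOCSTRING (mathematics and citations; read `𝐁` as the bond datum `𝔅`):
# `Balaban1983to89.B15Prop1LocalChartFromThm1AtBaseCentral` — [Balaban1985Variational] = «[15]», Thm 1 p. 279, (2) p. 278 (the class on the domains `Ω_j`), (4) p. 278, Prop. 8 p. 305,
# Prop. 9 p. 309; [Balaban1988Convergent] = «[III]», (2.10)–(2.12) p. 256: THE LOCAL-CLASS EDITION of `B15Prop1LocalChartFromThm1AtBase` ∕ `B15Prop1GaugeSectionOfForest` §2 —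
# the class letter «`reg'` guarded below `k` everywhere» replaced by its consequence actually used: «the `𝐁`-restricted averages are CONTINUOUS on `reg'`»

Honest framing: statement-level skeleton of published theorems with citation tags; proofs where landed; nothing here is a claim about the
Yang–Mills mass gap.  Cell `pub-ymgap`, HUMAN RULING D-0149 (width seats), seat `pub-ymgap-dag-n12-w1` (g3; N12 = [B15]; U1a⁺ of the w1 lineage, rule (ii)); `--kind proof
--supports` the K1 item of record; count-neutral; N12 NOT discharged; finite 𝕋⁴ at fixed ε; nothing continuum ∕ ℝ⁴ ∕ OS ∕ mass-gap ∕ Clay.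

WHY (two located points on this seat's own g3 files, both repaired here).  (1) CENTRAL, NOT RESIDUAL: the residual form of (T1@q₀) («`∃ u`, `u = 1` at the block towers,
`U^u = U₀`») is FALSE in general — if the tower-site constraint graph of `𝐁` has two components not linked by a constrained bond and `U₀` is irreducible, `v := −1` on one component,
`+1` on the other preserves the action, the class and EVERY datum on `𝐁` (central values, equal along each constrained bond), so `U₀^v` is a second minimiser on the base fibre, far
from `U₀`, outside its residual orbit (`Stab U₀ = {±1}`).  Print's Thm 1 ([15] p. 279; [III] (2.12) «the minimal orbit, i.e., the set of minima») is uniqueness under the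
DATUM-PRESERVING gauge transformations; under (β) these are exactly the tower-CENTRAL ones, and the compactness argument needs from the group only continuity, `A`-invariance and
`D`-invariance for all configurations (§0).  So (T1@q₀) reads «`toMS u j c₋ = toMS u j c₊` commuting with `SU(2)`» in place of «`= 1`»; the section (S) keeps residual `u`.
(2) LOCAL CLASS LETTER (as in `…Local`): `hDreg' : ContinuousOn (U ↦ (↑(Ū U)_{(j,c)})_{(j,c) ∈ 𝐁}) reg'` instead of the global (0.4) guard, which NODE 00's class ([15] (2) on the
domains `Ω_j`) cannot inhabit.  Everything else is byte-for-byte the g3 argument.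

CONTENTS (0 `def`∕`instance`∕`sorry`).  §0 `datum_gaugeAct_of_central`; ★★★ `hcritT_isMinimizer_of_thm1AtBase_central`, `exists_localChart_at_baseField_of_thm1AtBase[_forest]_central`.
HONEST SCOPE: topology ∕ bookkeeping; (T1@q₀), (S)∕forest, (P8), `hcrit`, `honto`, `hnondeg`, the local class letter stay DISPLAYED; nothing of Bałaban's asserted; count-neutral; N12 NOT
discharged; the YM mass gap (Clay) is NOT proved by any of this — R4 closes only the conditional finite-𝕋⁴ rung `BalabanLadder.UV`.
-/


noncomputable section

namespace Literature.MathematicalPhysics.QuantumFieldTheory.Balaban1983to89.B15Prop1LocalChartFromThm1AtBaseCentralB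

open B15Prop1LocalChartFromThm1AtBaseCentral


open Set Metric Filter
open scoped Topology
open Literature.MathematicalPhysics.QuantumFieldTheory.Balaban1983to89.Node00 (SU coeField coeField_apply SmallBelow ConstrSetB constrCardB constrEnumB star_coe_mul_coe_SU)
open B15AveragingHolomorphic (iterMh coeField_iter_eq_iterMh differentiableAt_iterMh)
open B15ComplexifiedDatumFamily (conjVec)
open B15SU2ChartHolomorphic (expMulC logCoordC differentiableAt_logCoordC)
open B15Prop1StateChartSU2 (differentiable_expMulC_right)
open B15Prop1DatumCoordinates (eventually_smallBelow expMulC_zero_left logCoordC_one)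
open B15Prop1ComplexWilsonAction (contDiffAt_actionSum actionSum_expMulC_cplxVec)
open B15Prop1CriticalChartFromIFT (cplxVec_zero)
open B15Prop1ClassOpenAtRecord (isInducing_coeField)
open B15Prop1LocalChartAtBaseField (exists_localChart_at_baseField)
open B15Prop1SliceNondegeneracyFromRealCoercive (analyticAt_sliceAction analyticAt_sliceDatum)
open B15Prop1MinimiserFromBaseUniqueness (htransfer_isMin_of_thm1AtBase)
open B15Prop1LocalChartFromThm1AtBase (agreeOn_iff_datum_eq continuousAt_datum)
open B15Prop1GaugeSectionOfForest (gaugeSection_of_forest)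
open Literature.Analysis.Calculus.ConstrainedCriticalPointLocallyUnique (exists_nhds_critical_unique)
open B14Eq16FaddeevPopov (wilsonAction4_gaugeAct')
open B16Thm1BaseAtRecord11 (continuous_wilsonAction4_SU)
open B12ContinuousTransportInvariance (continuous_gaugeAct_SU)
open B16Sect1Backgrounds (toMS iter_gaugeAct expMul expMul_zero)
open B15Prop1AnalyticExtClause (cplxVec)
open B15Prop1ChartSU2 (su2Chart)
open ExpMeanLog (expMeanLogSU)
open BlockAveraging (blockAvg)
open T4CubeChartGnomonic (SU2)
open T4Continuum B15DeterminingSets B15DeterminingSetsB GaugeField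
open scoped Matrix.Norms.L2Operator

variable {P : Params}



section
variable (𝔅 : BDetSet P) (k : ℕ)

/-- **GAUGE TRANSFORMATIONS CENTRAL AT THE BLOCK TOWERS DO NOT MOVE THE DATUM**: if at the block-tower sites of the two endpoints of every constrained bond of levels `≤ k` the gauge
transformation takes ONE value that commutes with every group element (print's residual group (4) has the value `1`; the centre `{±1}` of `SU(2)` is the general datum-preserving
case), then `Ū^j(U^u)(c) = Ū^j(U)(c)` at every constrained bond (gauge covariance of the averages, [Balaban1985Averaging] (11)). [cite: Balaban1985Variational, (4) p.278; Balaban1985Averaging, (11) p.19] -/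
theorem datum_gaugeAct_of_central (hk : k ≤ P.m + P.K) (av : ∀ j, Averaging P j SU2) (u : GaugeTransf P 0 SU2)
    (hu : ∀ j, j ≤ k → ∀ b ∈ (𝔅 j), toMS u j b.src = toMS u j b.tgt ∧ ∀ g : SU2, toMS u j b.src * g = g * toMS u j b.src) (U : GaugeField P 0 SU2)
    (i : Fin (constrCardB 𝔅 k)) :
    avgFamily av (gaugeAct u U) ((constrEnumB 𝔅 k).symm i).1 ((constrEnumB 𝔅 k).symm i).2.1 =
      avgFamily av U ((constrEnumB 𝔅 k).symm i).1 ((constrEnumB 𝔅 k).symm i).2.1 := by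
  set s := (constrEnumB 𝔅 k).symm i
  have hj : (s.1 : ℕ) ≤ k := Nat.le_of_lt_succ s.1.2
  obtain ⟨heq, hcomm⟩ := hu s.1 hj s.2.1 s.2.2
  show Averaging.iter av s.1 (gaugeAct u U) s.2.1 = Averaging.iter av s.1 U s.2.1
  rw [iter_gaugeAct av u U s.1 (hj.trans hk)]
  simp only [GaugeField.gaugeAct]
  rw [← heq, hcomm, mul_inv_cancel_right]

end

end Literature.MathematicalPhysics.QuantumFieldTheory.Balaban1983to89.B15Prop1LocalChartFromThm1AtBaseCentralB

end
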